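import Summits.BirchSwinnertonDyer.BirchSwinnertonDyer.Theorems.SignedLowerHalvesKobayashiLowerHalfLargeImageMuPartAlgebra
import Summits.BirchSwinnertonDyer.BirchSwinnertonDyer.Theorems.SignedLowerHalvesKobayashiLowerHalfLargeImageCommonZeroSqueezeSignBlindDefectOfFacts
import Summits.BirchSwinnertonDyer.Rank1Residual.X1.MuPart
import Literature.NumberTheory.EllipticCurves.Kobayashi2003.SignedSelmerDualExistsProofs
import Literature.NumberTheory.EllipticCurves.Kobayashi2003.SignedSelmerTorsion
import Literature.NumberTheory.EllipticCurves.PlusMinusPAdicLFunctionProofs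
import HarnessLib

/-!
# Route `SignedLowerHalves`, crux 3 `KobayashiLowerHalfLargeImage` (item stmt-BirchSwinnertonDyer-19001):
# the μ-PART of Kobayashi's signed main conjecture at LARGE IMAGE, BOTH SIGNS (part B) —
# `μ(X^ε(E/ℚ_∞)) = μ(L_p^ε(E))` for `ε = ±`, at `p = 3` modulo published named facts, at `p ≥ 5` modulo B⁰
# (cell `bsd-ssimc`, width seat `bsd-line-slh-p1-w6` gen 0; helper file `--supports 19001`; THEOREMS ONLY)

HONEST FRAMING.  The crux (the Eisenstein half of Kobayashi's signed main conjecture on the X7 large-image class) is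
OPEN and nothing here proves it; BSD is not proved by any of this.  What this file proves is the μ-PART of the
target divisibility, for both signs, at every pair of the crux's class with `p = 3` (and at `p ≥ 5` granted Conjecture
B⁰): the crux's open content at such a pair is a statement about λ-invariants / distinguished polynomials only.

## The observation (two landed objects multiplied together)

* The SIGN-BLIND KATO DEFECT of line `commonzero_squeeze` (S1, landed by width seat w2 g3 as
  `CommonZeroSqueeze.signBlindDefect_of_facts`): at an odd good prime `p` with `a_p = 0` and `ρ̄_{E,p}` onto, for
  every cyclotomic frame, the newform `f` and every Pollack pair `(L⁺, L⁻)` there is ONE `δ ∈ Λ` with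
  `(ξ^ε·δ) = (L_p^ε)` for BOTH signs `ε` and every dual datum (`char X^ε = (ξ^ε)`), GRANTED the published named facts
  Kobayashi Thm. 1.2 (`h12`), Thm. 4.1 (`h41`), the period facts (`h5`, `h3`) and the joint `±` Coleman–Kato package
  (`hJ = Kobayashi2003.thm62_63_73_signedColemanKato_zetaJoint`).  Hence `μ(ξ^ε) + μ(δ) = μ(L_p^ε)` for both signs.
* The μ-FLOOR (`LargeImageMuFloor`, p647857): `μ(L_p^{ε₀}) = 0` for SOME sign `ε₀` — INPUT-FREE at `p = 3` (THEOREM B on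
  Vaserstein's theorem, slh-p3's p643729) and granted Conjecture B⁰ `TeichSpanGenAll` at `p ≥ 5`.
So `μ(δ) = 0`, whence **`μ(ξ^ε) = μ(L_p^ε)` for BOTH signs** — the μ-part of Kobayashi's main conjecture — and for the
sign `ε₀`, `μ(X^{ε₀}) = 0`.  Consequently the λ-defect `λ(L_p^ε) − λ(ξ^ε) = λ(δ)` is the same non-negative integer
for both signs, and the full signed main conjecture for EITHER sign at the pair is `λ(δ) = 0`.

## Contents (theorems only; part B — §§1–2 (the `Λ`-algebra and `min(μ(L⁺), μ(L⁻)) = 0` / the S2 reduction of line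
`commonzero_squeeze`) are in `…LargeImageMuPartAlgebra.lean`; `μ`, `λ` of an element of `Λ` are `X1.MuLambda.mu` / `lam`)

* §3 everything first from the μ-floor AS A HYPOTHESIS (`…_of_muFloor`), then at `p = 3` modulo PUBLISHED facts only
  (`mu_charGen_eq_mu_kobayashiL_three`) and at odd `p` under B⁰: the sign-blind defect has `μ = 0`
  (`exists_signBlindDefect_hasUnitContent`), **`mu_charGen_eq_mu_kobayashiL`** (`μ(ξ^ε) = μ(L_p^ε)`, both signs),
  **`signedMu_eq_mu_kobayashiL`** (`D.mu = μ(L_p^ε)` — Kobayashi's `μ^ε` of `X^ε(E/ℚ_∞)`), `exists_sign_signedMu_eq_zero`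
  (one sign has `μ(X^ε) = 0`), `exists_signBlindLamDefect` (the λ-defect `λ(L_p^ε) − λ(ξ^ε) = λ(δ)` is one sign-free
  natural number, the μ-defect is `0`, and at the pair `char X^ε = (L_p^ε)` ⟺ `λ(δ) = 0` for either sign).

CALIBRATION / SUPPORT ONLY (pen rule D34-4 (3)): never an input to a registered stub, a `closes`, or a by-name close of
item 19001.  Class: `p` odd good, `a_p = 0`, `ρ̄_{E,p}` onto — the crux's binders minus X7/¬CM (not needed).

References: [Kobayashi2003] Thm. 1.2, Thm. 1.4 (the invariants), Thm. 4.1, (7.21), proof of Thm. 7.4 (p. 13);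
[Kato2004Asterisque] Thm. 12.6; [KuriharaPollack2007] §1.5, Problem 3.2; [GreenbergVatsal2000] p. 2 (1)–(2), §3 Rem. 3.4;
[Washington1997] §7.1, §13.2; [PollackWeston2011] Thm. 4.1 (1), Rem. 4.2; [Vaserstein1972SL2] Theorem; [Pollack2003] Prop. 6.18.
-/

-- D-0017: single-problem summit, the namespace repeats the problem name by design.
set_option linter.dupNamespace false
set_option autoImplicit false

noncomputable section

open scoped Classical MatrixGroups ModularForm

open CongruenceSubgroup WeierstrassCurve Literature.NumberTheory.EllipticCurves
  Literature.NumberTheory.EllipticCurves.ModularForms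
  Literature.NumberTheory.EllipticCurves.Kobayashi2003 Literature.NumberTheory.EllipticCurves.GreenbergVatsal2000
  Literature.NumberTheory.EllipticCurves.Rank1Residual ZpExtension
  Summit.BirchSwinnertonDyer.Rank1Residual.Supersingular

namespace Summit.BirchSwinnertonDyer.BirchSwinnertonDyer.Theorems.LargeImageMuPart

open Summit.BirchSwinnertonDyer.Rank1Residual.X1.MuLambda (mu lam)
open Summit.BirchSwinnertonDyer.Rank1Residual.X11a (mu_eq_zero_of_hasUnitContent)
open Summit.BirchSwinnertonDyer.BirchSwinnertonDyer.Cruxes.AnalyticMuZeroX9.TeichSpan (TeichSpanGenAll)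
open Summit.BirchSwinnertonDyer.BirchSwinnertonDyer.Theorems.CommonZeroSqueeze (signBlindDefect_of_facts)

/-! ## §3 The sign-blind defect has `μ = 0`; the μ-part of Kobayashi's main conjecture for both signs

Every statement is first proved from the μ-FLOOR AS A HYPOTHESIS (`hfloor : ∃ ε₀, μ(kobayashiL ε₀ L⁺ L⁻) = 0` for the
newform and every Pollack pair — the W-level shape of `LargeImageMuFloor`), then instantiated twice: at `p = 3`
INPUT-FREE (`LargeImageMuFloor.signedMuFloor_three`) and at odd `p` from Conjecture B⁰
(`LargeImageMuFloor.signedMuFloor_of_teichSpanGenAll`, B⁰ used only at `p ≥ 5`). -/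

section MuPart

variable {p : ℕ} [Fact p.Prime] {W : WeierstrassCurve ℚ} [W.IsElliptic] [W.IsGloballyMinimal]

/-- **S1 with `μ(δ) = 0`, from the μ-floor as a hypothesis.**  GRANTED the published named facts `h12`, `h41`, `h5`,
`h3`, `hJ` (as in `CommonZeroSqueeze.signBlindDefect_of_facts`) and the μ-floor `hfloor` at `(W, p)`: for `p` odd good,
`a_p = 0`, `ρ̄_{E,p}` onto, every cyclotomic frame, the newform and every Pollack pair, there is ONE `δ ∈ Λ` WITH UNIT
CONTENT such that `char X^ε = (ξ)` with `(ξ·δ) = (L_p^ε)` for both signs and every dual datum.  Proof: S1's `δ` divides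
`L_p^{ε₀}` for the μ-floor sign `ε₀` (a datum of sign `ε₀` exists, `nonempty_signedSelmerDualData`).
[cite: Kobayashi2003, proof of Thm. 7.4 (p. 13), Thm. 4.1, Thm. 1.2] [cite: Kato2004Asterisque, Thm. 12.6] -/
theorem exists_signBlindDefect_hasUnitContent_of_muFloor
    (h12 : Kobayashi2003.thm12_signedSelmerDual_finite_torsion)
    (h41 : Kobayashi2003.thm41_signedCharIdeal_divisibility)
    (h5 : realPeriodRat_eq_unit_mul_plusPeriod) (h3 : realPeriodRat_eq_unit_mul_plusPeriod_three)
    (hJ : Kobayashi2003.thm62_63_73_signedColemanKato_zetaJoint)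
    (hfloor : ∃ ε₀ : ℤˣ, ∀ [NeZero (W.conductorNorm ℤ)] (f : CuspForm (Gamma0 (W.conductorNorm ℤ)) 2),
      IsNewformOf W f → ∀ Lplus Lminus : IwasawaAlgebra p, IsPollackPair f p Lplus Lminus →
        HasUnitContent (kobayashiL ε₀ Lplus Lminus))
    (hp2 : p ≠ 2) (hgood : W.HasGoodReductionAtPrime p) (hap : W.frobeniusTrace p = 0) (hs : Surj W p)
    {κ : ZpExtension ℚ p} {γ : Field.absoluteGaloisGroup ℚ} (hκ : κ.IsCyclotomic)
    (hγ : κ.IsTopGenerator γ) (hγc : IsCyclotomicVariable p γ) [NeZero (W.conductorNorm ℤ)]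
    {f : CuspForm (Gamma0 (W.conductorNorm ℤ)) 2} (hf : IsNewformOf W f)
    {Lplus Lminus : IwasawaAlgebra p} (hPP : IsPollackPair f p Lplus Lminus) :
    ∃ δ : IwasawaAlgebra p, HasUnitContent δ ∧ ∀ (ε : ℤˣ) (D : Kobayashi2003.SignedSelmerDualData W κ γ ε),
      ∃ ξ : IwasawaAlgebra p, D.charIdeal = Ideal.span {ξ} ∧
        Ideal.span {ξ * δ} = Ideal.span {kobayashiL ε Lplus Lminus} := by
  obtain ⟨δ, hδ⟩ :=
    signBlindDefect_of_facts h12 h41 h5 h3 hJ W p hp2 hgood hap hs κ γ hκ hγ hγc f hf Lplus Lminus hPP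
  obtain ⟨ε₀, hε₀⟩ := hfloor
  obtain ⟨D₀⟩ := nonempty_signedSelmerDualData W κ ε₀ hγ
  obtain ⟨ξ₀, -, hspan⟩ := hδ ε₀ D₀
  refine ⟨δ, ?_, hδ⟩
  have hmem : kobayashiL ε₀ Lplus Lminus ∈ Ideal.span ({ξ₀ * δ} : Set (IwasawaAlgebra p)) := by
    rw [hspan]; exact Ideal.mem_span_singleton_self _
  obtain ⟨c, hc⟩ := Ideal.mem_span_singleton.mp hmem
  have hdvd : δ ∣ kobayashiL ε₀ Lplus Lminus := ⟨ξ₀ * c, by rw [hc]; ring⟩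
  exact hasUnitContent_of_dvd hdvd (hε₀ f hf Lplus Lminus hPP)

/-- **`μ(ξ^ε) = μ(L_p^ε)` for both signs, from the μ-floor as a hypothesis** (and `ξ ≠ 0`).  Same named facts; `p` odd
good, `a_p = 0`, `ρ̄_{E,p}` onto; every frame, the newform, every Pollack pair, every sign, datum and generator.
[cite: Kobayashi2003, Thm. 1.4 (the invariants), proof of Thm. 7.4 (p. 13)] [cite: GreenbergVatsal2000, p. 2, (1)–(2)] -/
theorem mu_charGen_eq_mu_kobayashiL_of_muFloor
    (h12 : Kobayashi2003.thm12_signedSelmerDual_finite_torsion)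
    (h41 : Kobayashi2003.thm41_signedCharIdeal_divisibility)
    (h5 : realPeriodRat_eq_unit_mul_plusPeriod) (h3 : realPeriodRat_eq_unit_mul_plusPeriod_three)
    (hJ : Kobayashi2003.thm62_63_73_signedColemanKato_zetaJoint)
    (hfloor : ∃ ε₀ : ℤˣ, ∀ [NeZero (W.conductorNorm ℤ)] (f : CuspForm (Gamma0 (W.conductorNorm ℤ)) 2),
      IsNewformOf W f → ∀ Lplus Lminus : IwasawaAlgebra p, IsPollackPair f p Lplus Lminus →
        HasUnitContent (kobayashiL ε₀ Lplus Lminus))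
    (hp2 : p ≠ 2) (hgood : W.HasGoodReductionAtPrime p) (hap : W.frobeniusTrace p = 0) (hs : Surj W p)
    {κ : ZpExtension ℚ p} {γ : Field.absoluteGaloisGroup ℚ} (hκ : κ.IsCyclotomic)
    (hγ : κ.IsTopGenerator γ) (hγc : IsCyclotomicVariable p γ) [NeZero (W.conductorNorm ℤ)]
    {f : CuspForm (Gamma0 (W.conductorNorm ℤ)) 2} (hf : IsNewformOf W f)
    {Lplus Lminus : IwasawaAlgebra p} (hPP : IsPollackPair f p Lplus Lminus)
    (ε : ℤˣ) (D : Kobayashi2003.SignedSelmerDualData W κ γ ε) {ξ : IwasawaAlgebra p}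
    (hξ : D.charIdeal = Ideal.span {ξ}) :
    mu ξ = mu (kobayashiL ε Lplus Lminus) ∧ ξ ≠ 0 := by
  obtain ⟨δ, hδu, hδ⟩ :=
    exists_signBlindDefect_hasUnitContent_of_muFloor h12 h41 h5 h3 hJ hfloor hp2 hgood hap hs hκ hγ hγc hf hPP
  obtain ⟨ξ', hξ', hspan⟩ := hδ ε D
  have hL0 : kobayashiL ε Lplus Lminus ≠ 0 := by
    rcases Int.units_eq_one_or ε with rfl | rfl
    · simpa [kobayashiL] using hPP.2.1
    · have hne : (-1 : ℤˣ) ≠ 1 := by decide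
      simpa [kobayashiL, hne] using hPP.1
  obtain ⟨hmu', -⟩ := mu_eq_and_lam_add_eq_of_span_mul_eq_span hL0 hδu hspan
  have hξ'0 : ξ' ≠ 0 := by
    intro h0
    rw [h0, zero_mul, Ideal.span_singleton_eq_span_singleton] at hspan
    exact hL0 (zero_dvd_iff.mp hspan.dvd)
  have hspan' : Ideal.span ({ξ'} : Set (IwasawaAlgebra p)) = Ideal.span {ξ} := by rw [← hξ', hξ]
  obtain ⟨hmu, -⟩ := mu_eq_and_lam_eq_of_span_eq hξ'0 hspan'
  have hξ0 : ξ ≠ 0 := by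
    intro h0
    rw [h0, Ideal.span_singleton_eq_span_singleton] at hspan'
    exact hξ'0 (zero_dvd_iff.mp hspan'.symm.dvd)
  exact ⟨hmu ▸ hmu', hξ0⟩

/-- **The λ-defect is SIGN-FREE and the μ-defect is ZERO, from the μ-floor as a hypothesis.**  For every sign `ε`, dual
datum `D` and generator `ξ` of `char X^ε`: `λ(ξ) + d = λ(L_p^ε)` and `μ(ξ) = μ(L_p^ε)` for ONE natural number `d`
(`= λ(δ)`), and `char X^ε = (L_p^ε)` ⟺ `d = 0`. [cite: Kobayashi2003, proof of Thm. 7.4 (p. 13)] [cite: GreenbergVatsal2000, p. 4] -/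
theorem exists_signBlindLamDefect_of_muFloor
    (h12 : Kobayashi2003.thm12_signedSelmerDual_finite_torsion)
    (h41 : Kobayashi2003.thm41_signedCharIdeal_divisibility)
    (h5 : realPeriodRat_eq_unit_mul_plusPeriod) (h3 : realPeriodRat_eq_unit_mul_plusPeriod_three)
    (hJ : Kobayashi2003.thm62_63_73_signedColemanKato_zetaJoint)
    (hfloor : ∃ ε₀ : ℤˣ, ∀ [NeZero (W.conductorNorm ℤ)] (f : CuspForm (Gamma0 (W.conductorNorm ℤ)) 2),
      IsNewformOf W f → ∀ Lplus Lminus : IwasawaAlgebra p, IsPollackPair f p Lplus Lminus →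
        HasUnitContent (kobayashiL ε₀ Lplus Lminus))
    (hp2 : p ≠ 2) (hgood : W.HasGoodReductionAtPrime p) (hap : W.frobeniusTrace p = 0) (hs : Surj W p)
    {κ : ZpExtension ℚ p} {γ : Field.absoluteGaloisGroup ℚ} (hκ : κ.IsCyclotomic)
    (hγ : κ.IsTopGenerator γ) (hγc : IsCyclotomicVariable p γ) [NeZero (W.conductorNorm ℤ)]
    {f : CuspForm (Gamma0 (W.conductorNorm ℤ)) 2} (hf : IsNewformOf W f)
    {Lplus Lminus : IwasawaAlgebra p} (hPP : IsPollackPair f p Lplus Lminus) :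
    ∃ d : ℕ, ∀ (ε : ℤˣ) (D : Kobayashi2003.SignedSelmerDualData W κ γ ε) (ξ : IwasawaAlgebra p),
      D.charIdeal = Ideal.span {ξ} →
        lam ξ + d = lam (kobayashiL ε Lplus Lminus) ∧ mu ξ = mu (kobayashiL ε Lplus Lminus) ∧
        (D.charIdeal = Ideal.span {kobayashiL ε Lplus Lminus} ↔ d = 0) := by
  obtain ⟨δ, hδu, hδ⟩ :=
    exists_signBlindDefect_hasUnitContent_of_muFloor h12 h41 h5 h3 hJ hfloor hp2 hgood hap hs hκ hγ hγc hf hPP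
  refine ⟨lam δ, fun ε D ξ hξ ↦ ?_⟩
  obtain ⟨ξ', hξ', hspan⟩ := hδ ε D
  have hL0 : kobayashiL ε Lplus Lminus ≠ 0 := by
    rcases Int.units_eq_one_or ε with rfl | rfl
    · simpa [kobayashiL] using hPP.2.1
    · have hne : (-1 : ℤˣ) ≠ 1 := by decide
      simpa [kobayashiL, hne] using hPP.1
  have hξ'0 : ξ' ≠ 0 := by
    intro h0
    rw [h0, zero_mul, Ideal.span_singleton_eq_span_singleton] at hspan
    exact hL0 (zero_dvd_iff.mp hspan.dvd)
  have hspan' : Ideal.span ({ξ'} : Set (IwasawaAlgebra p)) = Ideal.span {ξ} := by rw [← hξ', hξ]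
  obtain ⟨hmuξ, hlamξ⟩ := mu_eq_and_lam_eq_of_span_eq hξ'0 hspan'
  obtain ⟨hmu', hlam'⟩ := mu_eq_and_lam_add_eq_of_span_mul_eq_span hL0 hδu hspan
  obtain ⟨h1, h2⟩ := span_eq_iff_lam_eq_of_span_mul_eq_span hL0 hδu hspan
  refine ⟨by rw [← hlamξ]; exact hlam', by rw [← hmuξ]; exact hmu', ?_⟩
  rw [hξ, ← hspan', h1, h2]

/-! ### `p = 3`: INPUT-FREE μ-floor ⟹ everything above modulo PUBLISHED facts only -/

/-- **`μ(ξ^ε) = μ(L₃^ε)` for both signs at `p = 3`, modulo PUBLISHED named facts only** (`h12`, `h41`, `h5`, `h3`,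
`hJ`): for `W/ℚ` globally minimal with good reduction at `3`, `a₃ = 0`, `ρ̄_{E,3}` onto (the binder shape `p = 3 →` of
the line of record's `stub_three`), every frame, the newform, every Pollack pair, every sign, datum and generator.
[cite: Kobayashi2003, Thm. 1.4 (the invariants)] [cite: Vaserstein1972SL2, Theorem] [cite: PollackWeston2011, Rem. 4.2] -/
theorem mu_charGen_eq_mu_kobayashiL_three
    (h12 : Kobayashi2003.thm12_signedSelmerDual_finite_torsion)
    (h41 : Kobayashi2003.thm41_signedCharIdeal_divisibility)
    (h5 : realPeriodRat_eq_unit_mul_plusPeriod) (h3 : realPeriodRat_eq_unit_mul_plusPeriod_three)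
    (hJ : Kobayashi2003.thm62_63_73_signedColemanKato_zetaJoint)
    (hp3 : p = 3) (hgood : W.HasGoodReductionAtPrime p) (hap : W.frobeniusTrace p = 0) (hs : Surj W p)
    {κ : ZpExtension ℚ p} {γ : Field.absoluteGaloisGroup ℚ} (hκ : κ.IsCyclotomic)
    (hγ : κ.IsTopGenerator γ) (hγc : IsCyclotomicVariable p γ) [NeZero (W.conductorNorm ℤ)]
    {f : CuspForm (Gamma0 (W.conductorNorm ℤ)) 2} (hf : IsNewformOf W f)
    {Lplus Lminus : IwasawaAlgebra p} (hPP : IsPollackPair f p Lplus Lminus)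
    (ε : ℤˣ) (D : Kobayashi2003.SignedSelmerDualData W κ γ ε) {ξ : IwasawaAlgebra p}
    (hξ : D.charIdeal = Ideal.span {ξ}) :
    mu ξ = mu (kobayashiL ε Lplus Lminus) ∧ ξ ≠ 0 :=
  mu_charGen_eq_mu_kobayashiL_of_muFloor h12 h41 h5 h3 hJ
    (LargeImageMuFloor.signedMuFloor_three (W := W) p hp3 hgood hap) (by subst hp3; decide) hgood hap hs hκ hγ hγc hf hPP ε D hξ

/-! ### Odd `p`: the μ-floor from B⁰ (used only at `p ≥ 5`) -/

/-- **S1 with `μ(δ) = 0`.**  GRANTED the published named facts `h12`, `h41`, `h5`, `h3`, `hJ` and Conjecture B⁰ (used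
only at `p ≥ 5`): for `p` odd good, `a_p = 0`, `ρ̄_{E,p}` onto, every frame, the newform and every Pollack pair, ONE
`δ ∈ Λ` with unit content and `(ξ^ε·δ) = (L_p^ε)` for both signs and every dual datum.
[cite: Kobayashi2003, proof of Thm. 7.4 (p. 13), Thm. 4.1, Thm. 1.2] [cite: Kato2004Asterisque, Thm. 12.6] [cite: PollackWeston2011, Rem. 4.2] -/
theorem exists_signBlindDefect_hasUnitContent
    (h12 : Kobayashi2003.thm12_signedSelmerDual_finite_torsion)
    (h41 : Kobayashi2003.thm41_signedCharIdeal_divisibility)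
    (h5 : realPeriodRat_eq_unit_mul_plusPeriod) (h3 : realPeriodRat_eq_unit_mul_plusPeriod_three)
    (hJ : Kobayashi2003.thm62_63_73_signedColemanKato_zetaJoint) (hB : TeichSpanGenAll)
    (hp2 : p ≠ 2) (hgood : W.HasGoodReductionAtPrime p) (hap : W.frobeniusTrace p = 0) (hs : Surj W p)
    {κ : ZpExtension ℚ p} {γ : Field.absoluteGaloisGroup ℚ} (hκ : κ.IsCyclotomic)
    (hγ : κ.IsTopGenerator γ) (hγc : IsCyclotomicVariable p γ) [NeZero (W.conductorNorm ℤ)]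
    {f : CuspForm (Gamma0 (W.conductorNorm ℤ)) 2} (hf : IsNewformOf W f)
    {Lplus Lminus : IwasawaAlgebra p} (hPP : IsPollackPair f p Lplus Lminus) :
    ∃ δ : IwasawaAlgebra p, HasUnitContent δ ∧ ∀ (ε : ℤˣ) (D : Kobayashi2003.SignedSelmerDualData W κ γ ε),
      ∃ ξ : IwasawaAlgebra p, D.charIdeal = Ideal.span {ξ} ∧
        Ideal.span {ξ * δ} = Ideal.span {kobayashiL ε Lplus Lminus} :=
  exists_signBlindDefect_hasUnitContent_of_muFloor h12 h41 h5 h3 hJ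
    (LargeImageMuFloor.signedMuFloor_of_teichSpanGenAll (W := W) hB hp2 hgood hap) hp2 hgood hap hs hκ hγ hγc hf hPP

/-- **THE μ-PART OF KOBAYASHI'S MAIN CONJECTURE, BOTH SIGNS, AT LARGE IMAGE: `μ(ξ^ε) = μ(L_p^ε)`** (and `ξ ≠ 0`).
GRANTED `h12`, `h41`, `h5`, `h3`, `hJ` (published named facts) and B⁰ (only at `p ≥ 5`): for `W/ℚ` globally minimal, `p`
odd good, `a_p = 0`, `ρ̄_{E,p}` onto, every cyclotomic frame, the newform, every Pollack pair, EVERY sign `ε`, every dual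
datum `D` of `Sel^ε(E/ℚ_∞)` and every generator `ξ` of `char X^ε`: `μ(ξ) = μ(kobayashiL ε L⁺ L⁻)`.
[cite: Kobayashi2003, Thm. 1.4 (the invariants), proof of Thm. 7.4 (p. 13)] [cite: GreenbergVatsal2000, p. 2, (1)–(2)] -/
theorem mu_charGen_eq_mu_kobayashiL
    (h12 : Kobayashi2003.thm12_signedSelmerDual_finite_torsion)
    (h41 : Kobayashi2003.thm41_signedCharIdeal_divisibility)
    (h5 : realPeriodRat_eq_unit_mul_plusPeriod) (h3 : realPeriodRat_eq_unit_mul_plusPeriod_three)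
    (hJ : Kobayashi2003.thm62_63_73_signedColemanKato_zetaJoint) (hB : TeichSpanGenAll)
    (hp2 : p ≠ 2) (hgood : W.HasGoodReductionAtPrime p) (hap : W.frobeniusTrace p = 0) (hs : Surj W p)
    {κ : ZpExtension ℚ p} {γ : Field.absoluteGaloisGroup ℚ} (hκ : κ.IsCyclotomic)
    (hγ : κ.IsTopGenerator γ) (hγc : IsCyclotomicVariable p γ) [NeZero (W.conductorNorm ℤ)]
    {f : CuspForm (Gamma0 (W.conductorNorm ℤ)) 2} (hf : IsNewformOf W f)
    {Lplus Lminus : IwasawaAlgebra p} (hPP : IsPollackPair f p Lplus Lminus)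
    (ε : ℤˣ) (D : Kobayashi2003.SignedSelmerDualData W κ γ ε) {ξ : IwasawaAlgebra p}
    (hξ : D.charIdeal = Ideal.span {ξ}) :
    mu ξ = mu (kobayashiL ε Lplus Lminus) ∧ ξ ≠ 0 :=
  mu_charGen_eq_mu_kobayashiL_of_muFloor h12 h41 h5 h3 hJ
    (LargeImageMuFloor.signedMuFloor_of_teichSpanGenAll (W := W) hB hp2 hgood hap) hp2 hgood hap hs hκ hγ hγc hf hPP ε D hξ

/-- **Kobayashi's `μ^ε = μ(L_p^ε)` for both signs** (`D.mu`, the μ-invariant `muInvariant` of the `Λ`-module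
`X^ε(E/ℚ_∞)`): same hypotheses as `mu_charGen_eq_mu_kobayashiL`; the dictionary `μ(generator) = μ(module)` is the
tree's `X1.MuPart.mu_generator_eq_muInvariant` (structure theorem), finite generation and torsion are Thm. 1.2 (`h12`),
principality of `char X^ε` is part of S1's conclusion.
[cite: Kobayashi2003, Thm. 1.2, Thm. 1.4 (the invariants)] [cite: Washington1997, §13.2] -/
theorem signedMu_eq_mu_kobayashiL
    (h12 : Kobayashi2003.thm12_signedSelmerDual_finite_torsion)
    (h41 : Kobayashi2003.thm41_signedCharIdeal_divisibility)
    (h5 : realPeriodRat_eq_unit_mul_plusPeriod) (h3 : realPeriodRat_eq_unit_mul_plusPeriod_three)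
    (hJ : Kobayashi2003.thm62_63_73_signedColemanKato_zetaJoint) (hB : TeichSpanGenAll)
    (hp2 : p ≠ 2) (hgood : W.HasGoodReductionAtPrime p) (hap : W.frobeniusTrace p = 0) (hs : Surj W p)
    {κ : ZpExtension ℚ p} {γ : Field.absoluteGaloisGroup ℚ} (hκ : κ.IsCyclotomic)
    (hγ : κ.IsTopGenerator γ) (hγc : IsCyclotomicVariable p γ) [NeZero (W.conductorNorm ℤ)]
    {f : CuspForm (Gamma0 (W.conductorNorm ℤ)) 2} (hf : IsNewformOf W f)
    {Lplus Lminus : IwasawaAlgebra p} (hPP : IsPollackPair f p Lplus Lminus)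
    (ε : ℤˣ) (D : Kobayashi2003.SignedSelmerDualData W κ γ ε) :
    D.mu = mu (kobayashiL ε Lplus Lminus) := by
  obtain ⟨δ, -, hδ⟩ :=
    exists_signBlindDefect_hasUnitContent h12 h41 h5 h3 hJ hB hp2 hgood hap hs hκ hγ hγc hf hPP
  obtain ⟨ξ, hξ, -⟩ := hδ ε D
  obtain ⟨hmu, hξ0⟩ :=
    mu_charGen_eq_mu_kobayashiL h12 h41 h5 h3 hJ hB hp2 hgood hap hs hκ hγ hγc hf hPP ε D hξ
  haveI : Module.Finite (IwasawaAlgebra p) D.X := h12.moduleFinite hp2 hgood hap hκ hγ D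
  have hT : Module.IsTorsion (IwasawaAlgebra p) D.X := h12.isTorsion hp2 hgood hap hκ hγ D
  rw [← hmu]
  exact (Summit.BirchSwinnertonDyer.Rank1Residual.X1.MuPart.mu_generator_eq_muInvariant D.X hT hξ0 hξ).symm

/-- **One sign has `μ(X^ε(E/ℚ_∞)) = 0`** (sign before frame and newform): same named facts and B⁰ (only `p ≥ 5`); for
`W/ℚ` globally minimal, `p` odd good, `a_p = 0`, `ρ̄_{E,p}` onto, there is a sign `ε` with `D.mu = 0` for every
cyclotomic frame and every dual datum `D` of `Sel^ε(E/ℚ_∞)`.  (The μ-floor sign; Pollack's pair exists by the tree's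
THEOREM `pollack_exists_plusMinusPAdicLFunction_holds`; vacuous if `W` had no newform.)
[cite: Kobayashi2003, Thm. 1.2, Thm. 1.4 (the invariants)] [cite: PollackWeston2011, Rem. 4.2] [cite: Pollack2003, Thm. 5.6] -/
theorem exists_sign_signedMu_eq_zero
    (h12 : Kobayashi2003.thm12_signedSelmerDual_finite_torsion)
    (h41 : Kobayashi2003.thm41_signedCharIdeal_divisibility)
    (h5 : realPeriodRat_eq_unit_mul_plusPeriod) (h3 : realPeriodRat_eq_unit_mul_plusPeriod_three)
    (hJ : Kobayashi2003.thm62_63_73_signedColemanKato_zetaJoint) (hB : TeichSpanGenAll)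
    (hp2 : p ≠ 2) (hgood : W.HasGoodReductionAtPrime p) (hap : W.frobeniusTrace p = 0) (hs : Surj W p) :
    ∃ ε : ℤˣ, ∀ (κ : ZpExtension ℚ p) (γ : Field.absoluteGaloisGroup ℚ),
      κ.IsCyclotomic → κ.IsTopGenerator γ → IsCyclotomicVariable p γ →
      ∀ [NeZero (W.conductorNorm ℤ)] (f : CuspForm (Gamma0 (W.conductorNorm ℤ)) 2), IsNewformOf W f →
      ∀ D : Kobayashi2003.SignedSelmerDualData W κ γ ε, D.mu = 0 := by
  obtain ⟨ε, hε⟩ :=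
    LargeImageMuFloor.signedMuFloor_of_teichSpanGenAll (W := W) hB hp2 hgood hap
  refine ⟨ε, fun κ γ hκ hγ hγc _ f hf D ↦ ?_⟩
  obtain ⟨Lplus, Lminus, hPP⟩ :=
    exists_isPollackPair (pollack_exists_plusMinusPAdicLFunction_holds (W := W) (f := f) (p := p))
      hp2 hf hgood hap
  rw [signedMu_eq_mu_kobayashiL h12 h41 h5 h3 hJ hB hp2 hgood hap hs hκ hγ hγc hf hPP ε D]
  exact mu_eq_zero_of_hasUnitContent (hε f hf Lplus Lminus hPP)

/-- **The λ-defect is SIGN-FREE and the μ-defect is ZERO: at the pair, Kobayashi's main conjecture for either sign is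
ONE natural number `d = λ(δ) = 0`.**  Same named facts and B⁰ (only `p ≥ 5`).
[cite: Kobayashi2003, proof of Thm. 7.4 (p. 13)] [cite: GreenbergVatsal2000, p. 4 (after Thm. (1.2))] -/
theorem exists_signBlindLamDefect
    (h12 : Kobayashi2003.thm12_signedSelmerDual_finite_torsion)
    (h41 : Kobayashi2003.thm41_signedCharIdeal_divisibility)
    (h5 : realPeriodRat_eq_unit_mul_plusPeriod) (h3 : realPeriodRat_eq_unit_mul_plusPeriod_three)
    (hJ : Kobayashi2003.thm62_63_73_signedColemanKato_zetaJoint) (hB : TeichSpanGenAll)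
    (hp2 : p ≠ 2) (hgood : W.HasGoodReductionAtPrime p) (hap : W.frobeniusTrace p = 0) (hs : Surj W p)
    {κ : ZpExtension ℚ p} {γ : Field.absoluteGaloisGroup ℚ} (hκ : κ.IsCyclotomic)
    (hγ : κ.IsTopGenerator γ) (hγc : IsCyclotomicVariable p γ) [NeZero (W.conductorNorm ℤ)]
    {f : CuspForm (Gamma0 (W.conductorNorm ℤ)) 2} (hf : IsNewformOf W f)
    {Lplus Lminus : IwasawaAlgebra p} (hPP : IsPollackPair f p Lplus Lminus) :
    ∃ d : ℕ, ∀ (ε : ℤˣ) (D : Kobayashi2003.SignedSelmerDualData W κ γ ε) (ξ : IwasawaAlgebra p),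
      D.charIdeal = Ideal.span {ξ} →
        lam ξ + d = lam (kobayashiL ε Lplus Lminus) ∧ mu ξ = mu (kobayashiL ε Lplus Lminus) ∧
        (D.charIdeal = Ideal.span {kobayashiL ε Lplus Lminus} ↔ d = 0) :=
  exists_signBlindLamDefect_of_muFloor h12 h41 h5 h3 hJ
    (LargeImageMuFloor.signedMuFloor_of_teichSpanGenAll (W := W) hB hp2 hgood hap) hp2 hgood hap hs hκ hγ hγc hf hPP

end MuPart

end Summit.BirchSwinnertonDyer.BirchSwinnertonDyer.Theorems.LargeImageMuPart

end
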